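import Summits.BirchSwinnertonDyer.BirchSwinnertonDyer.Theorems.ResidualThetaTransportAtTwoPlusDualIsoLambdaTwo
import Summits.BirchSwinnertonDyer.BirchSwinnertonDyer.Theorems.ResidualThetaTransportAtTwoPlusDualHullExists
import Literature.NumberTheory.EllipticCurves.CharacterModuleQuotientDualityProofs
import Literature.NumberTheory.EllipticCurves.IwasawaTwistedCoinvariantsProofs
import Literature.NumberTheory.EllipticCurves.IwasawaAlgebraSpecializationCoprimeProofs
import Literature.NumberTheory.EllipticCurves.IwasawaAlgebraGenericTwistFiniteProofs
import HarnessLib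

/-!
# H-PLUSDUAL brick (K2) for item 23110: the twisted-eigenspace COUNT `#{s ∈ S : p^J s = 0, φ s = c s} = p^J` (`c ≡ 1 mod p`)
# for the dual pair of a module with `X ≃ₗ Λ` — and, at `2`, `#((⋃ₙE⁺(ℚ_{2,n}))/2^J)^{g = c} = 2^J` on points, unconditionally

Routes `ResidualThetaTransportAtTwo` (RTT, crux r201 `ResidualLambdaFormulaNegDiscAtTwo`, stmt-BirchSwinnertonDyer-23110) /
`ThetaPartnerAtTwo`. Seat `prover-bsd-wall-tp2-p2x-w2` g15; `--supports stmt-BirchSwinnertonDyer-23110`. THEOREMS ONLY (no definition,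
no named fact, no `sorry`); closes nothing.

WHY. In the `±`-duality at `2` (`hdual` of `…RlfTwistedUniformExponentNondeg`, Kim 2007 Prop. 3.18 read at `2`) the signed local
Kummer condition `L_u ≤ H¹(ℚ_v, E[2^J](χ_u))` has exactly `2^J` elements: by inflation–restriction it is the `γ = χ_u(g)^{∓1}`-eigenspace
of `(A ⊗ ℚ₂/ℤ₂)[2^J] = A/2^J A`, `A = ⋃ₙ E⁺(ℚ_{2,n})`, and `(A ⊗ ℚ₂/ℤ₂)^∨ ≅ Λ` ((R1)@2, `nonempty_linearEquiv_iwasawaAlgebra_two`).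
THIS FILE does the count:

* §1 `natCard_torsionBy_eigen_eq_pow` — for a dual pair `(X, toDual)` of `(S, φ − 1)` (`IwasawaDual.IsDualPair`) with `X ≃ₗ[Λ] Λ` and
  `c ≡ 1 (mod p)`: `#{s : p^J s = 0 ∧ φ s = c s} = p^J`. Two Pontryagin steps (tree `PontryaginCard.exists_quotSMulTop_addEquiv_characterModule_ker`:
  `Λ/p^J ≅ Hom(S[p^J], ℚ/ℤ)`, then `(Λ/p^J)/((1+T) − c) ≅ Hom(S[p^J]^{φ = c}, ℚ/ℤ)` — the constant `c` acts on `p^J`-torsion values as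
  the integer `c`, `IwasawaDual.toZModPow_val_smul_eq_zsmul`) and `#Λ/(p^J, T − (c−1)) = p^J` (`T − (c−1)` distinguished of degree `1`:
  tree `IwasawaAlgebra.card_quotient_span_coe_sup_span_C_pow`).
* §2 `natCard_torsionBy_eigen_eq_pow_of_hull` — the same for every realization `(S, φ, ι_k)` of the hull of `(A, γ)` satisfying the two
  point-level inputs of `PlusDual.nonempty_linearEquiv_of_hull`; `exists_residueSystem_eigen_of_hull` — POINT-LEVEL residue system:
  `p^J` elements `r ∈ A` with `γ r − c r ∈ p^J A`, pairwise incongruent mod `p^J A`, representing every such class.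
* §3 (`K = ℚ`, `p = 2`, `W` globally minimal, `GoodSS W 2`, `a₂ = 0`, cyclotomic `κ`, `v ∋ 2`, `g` a local lift of the generator)
  **`exists_residueSystem_plusEigen_two`** — for every odd `c` and every `J`: a residue system of EXACTLY `2^J` points of
  `A = ⋃ₙ E⁺(ℚ_{2,n})` for the classes `{a : g•a − c•a ∈ 2^J A} / 2^J A` — UNCONDITIONAL (`exists_divisibleHull` + (R1)@2).

HONEST FRAMING: closes nothing; `hdual` is NOT proved here; 23110 is NOT proved; BSD is not proved by any of this.
References: [BDKim2007] Prop. 3.15 («an explicit computation shows `#H⁻_n[p^j] = p^{jdp^n}`»), Prop. 3.17; [GreenbergLNM1716] §1 p. 60,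
§4 p. 98; [Washington1997] §7.1, §13.2 (Prop. 13.8).
-/

set_option autoImplicit false
-- D-0017: single-problem summit, so `Summit.BirchSwinnertonDyer.BirchSwinnertonDyer.…` repeats a namespace BY DESIGN.
set_option linter.dupNamespace false

noncomputable section

open scoped Classical NumberField
open Literature.NumberTheory.EllipticCurves Literature.NumberTheory.EllipticCurves.IwasawaDual

namespace Summit.BirchSwinnertonDyer.BirchSwinnertonDyer.Theorems.ResidualThetaLayer.PlusDual

/-! ## §1 The eigenspace count from `X ≃ₗ Λ` -/

section Count

variable {p : ℕ} [Fact p.Prime]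
variable {S : Type*} [AddCommGroup S] {φ : AddMonoid.End S}
variable {X : Type*} [AddCommGroup X] [Module (PowerSeries ℤ_[p]) X]
variable {toDual : X →+ (S →+ AddCircle (1 : ℚ))}

/-- **`#{s ∈ S : p^J s = 0 ∧ φ s = c s} = p^J` for `c ≡ 1 (mod p)`** when `(X, toDual)` is a dual pair of `(S, φ − 1)` with `X ≃ₗ[Λ] Λ`:
the characters of `S[p^J]^{φ = c}` are `Λ/(p^J, (1+T) − c)`, of order `p^J`. [cite: BDKim2007, Prop. 3.15 and Prop. 3.17]
[cite: Washington1997, §13.2 (Prop. 13.8)] -/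
theorem natCard_torsionBy_eigen_eq_pow (h : IsDualPair p (φ - 1) toDual) (e : X ≃ₗ[PowerSeries ℤ_[p]] PowerSeries ℤ_[p])
    (c : ℤ) (hc : (p : ℤ) ∣ c - 1) (J : ℕ) :
    Nat.card {s : S // p ^ J • s = 0 ∧ φ s = c • s} = p ^ J := by
  haveI : NeZero (p ^ J) := ⟨pow_ne_zero _ (Fact.out : p.Prime).ne_zero⟩
  set Λ := PowerSeries ℤ_[p] with hΛ
  -- the dual pair structure transported to `Λ`
  let d : Λ →+ (S →+ AddCircle (1 : ℚ)) := toDual.comp e.symm.toLinearMap.toAddMonoidHom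
  have hd : ∀ (f : Λ) (s : S), d f s = toDual (e.symm f) s := fun _ _ ↦ rfl
  have hdbij : Function.Bijective d := h.bijective.comp e.symm.bijective
  set I₁ : Submodule Λ Λ := (Ideal.span {((p ^ J : ℕ) : Λ)} : Ideal Λ) • ⊤ with hI₁
  -- step 1: `q₁ = p^J`, `ψ₁ = p^J •`
  let ψ₁ : S →+ S := DistribSMul.toAddMonoidHom S (p ^ J)
  have hψ₁ : ∀ s, ψ₁ s = p ^ J • s := fun _ ↦ rfl
  have hq₁ : ∀ (f : Λ) (s : S), d (((p ^ J : ℕ) : Λ) • f) s = d f (ψ₁ s) := by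
    intro f s
    rw [hd, hd, map_smul, Nat.cast_smul_eq_nsmul, nsmul_eval, hψ₁]
  obtain ⟨Ψ₁, hΨ₁⟩ := PontryaginCard.exists_quotSMulTop_addEquiv_characterModule_ker d hdbij ((p ^ J : ℕ) : Λ) ψ₁ hq₁
  -- step 2: on `X₁ = Λ/p^J`, `q₂ = (1+T) − c` acts as `φ − c` on `S[p^J]`
  let ψ₂ : ψ₁.ker →+ ψ₁.ker :=
    { toFun := fun a ↦ ⟨φ a - c • (a : S), by
        have ha : p ^ J • (a : S) = 0 := a.2
        rw [AddMonoidHom.mem_ker, hψ₁, smul_sub, ← map_nsmul, smul_comm, ha, map_zero, smul_zero, sub_zero]⟩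
      map_zero' := Subtype.ext (by simp)
      map_add' := fun a b ↦ Subtype.ext (by
        simp only [AddSubgroup.coe_add, map_add, smul_add, AddMemClass.mk_add_mk]
        abel) }
  have hψ₂ : ∀ a : ψ₁.ker, ((ψ₂ a : ψ₁.ker) : S) = φ a - c • (a : S) := fun _ ↦ rfl
  set q₂ : Λ := (1 + PowerSeries.X) - PowerSeries.C (c : ℤ_[p]) with hq₂def
  have hq₂ : ∀ (x : Λ ⧸ I₁) (a : ψ₁.ker), Ψ₁.toAddMonoidHom (q₂ • x) a = Ψ₁.toAddMonoidHom x (ψ₂ a) := by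
    intro x a
    obtain ⟨f, rfl⟩ := Submodule.Quotient.mk_surjective I₁ x
    have ha : p ^ J • (a : S) = 0 := a.2
    have ht : p ^ J • toDual (e.symm f) (a : S) = 0 := by rw [← map_nsmul, ha, map_zero]
    rw [← Submodule.Quotient.mk_smul, AddEquiv.coe_toAddMonoidHom, hΨ₁, hΨ₁]
    change toDual (e.symm (q₂ • f)) (a : S) = toDual (e.symm f) ((ψ₂ a : ψ₁.ker) : S)
    rw [map_smul, hq₂def, sub_smul, map_sub, AddMonoidHom.sub_apply, h.toDual_one_add_X_smul, h.C_smul _ _ _ J ha,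
      IwasawaDual.toZModPow_val_smul_eq_zsmul c ht, hψ₂, map_sub, map_zsmul]
  obtain ⟨Ψ₂, hΨ₂⟩ :=
    PontryaginCard.exists_quotSMulTop_addEquiv_characterModule_ker Ψ₁.toAddMonoidHom Ψ₁.bijective q₂ ψ₂ hq₂
  -- `ker ψ₂` is the eigenspace
  have hker : Nat.card ψ₂.ker = Nat.card {s : S // p ^ J • s = 0 ∧ φ s = c • s} := by
    refine Nat.card_congr
      { toFun := fun a ↦ ⟨((a : ψ₁.ker) : S), (a : ψ₁.ker).2, sub_eq_zero.mp ?_⟩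
        invFun := fun s ↦ ⟨⟨s.1, s.2.1⟩, ?_⟩
        left_inv := fun a ↦ rfl
        right_inv := fun s ↦ rfl }
    · have h0 := a.2
      rw [AddMonoidHom.mem_ker] at h0
      have h1 := congrArg (fun z : ψ₁.ker ↦ (z : S)) h0
      simpa only [hψ₂, ZeroMemClass.coe_zero] using h1
    · rw [AddMonoidHom.mem_ker]
      exact Subtype.ext (by rw [hψ₂, ZeroMemClass.coe_zero]; exact sub_eq_zero.mpr s.2.2)
  -- the double quotient is `Λ/(p^J, (1+T) − c)`, of order `p^J`
  have hcb : ((c : ℤ_[p]) - 1) ∈ IsLocalRing.maximalIdeal ℤ_[p] := by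
    rw [PadicInt.maximalIdeal_eq_span_p, Ideal.mem_span_singleton]
    obtain ⟨m, hm⟩ := hc
    exact ⟨(m : ℤ_[p]), by exact_mod_cast hm⟩
  set Q : Polynomial ℤ_[p] := Polynomial.X - Polynomial.C ((c : ℤ_[p]) - 1) with hQdef
  have hQ := IwasawaAlgebra.isDistinguishedAt_X_sub_C p hcb
  have hQcoe : ((Q : Polynomial ℤ_[p]) : Λ) = q₂ := by
    rw [hQdef, Polynomial.coe_sub, Polynomial.coe_X, Polynomial.coe_C, map_sub, map_one, hq₂def]
    ring
  have hpJ : (((p ^ J : ℕ) : Λ)) = PowerSeries.C ((p : ℤ_[p]) ^ J) := by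
    rw [map_pow, map_natCast, Nat.cast_pow]
  have hcountΛ : Nat.card (Λ ⧸ (I₁ ⊔ (Ideal.span {q₂} : Ideal Λ) • (⊤ : Submodule Λ Λ))) = p ^ J := by
    have hI : I₁ ⊔ (Ideal.span {q₂} : Ideal Λ) • (⊤ : Submodule Λ Λ) =
        Ideal.span {((Q : Polynomial ℤ_[p]) : Λ)} ⊔ Ideal.span {PowerSeries.C ((p : ℤ_[p]) ^ J)} := by
      rw [hI₁, Ideal.smul_eq_mul, Ideal.mul_top, Ideal.smul_eq_mul, Ideal.mul_top, hQcoe, hpJ, sup_comm]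
    rw [hI, IwasawaAlgebra.card_quotient_span_coe_sup_span_C_pow p hQ J, Polynomial.natDegree_X_sub_C, mul_one]
  have hmap : (I₁ ⊔ (Ideal.span {q₂} : Ideal Λ) • (⊤ : Submodule Λ Λ)).map I₁.mkQ =
      (Ideal.span {q₂} : Ideal Λ) • (⊤ : Submodule Λ (Λ ⧸ I₁)) := by
    rw [Submodule.map_sup, Submodule.mkQ_map_self, bot_sup_eq, Submodule.map_smul'', Submodule.map_top, Submodule.range_mkQ]
  have hcount : Nat.card ((Λ ⧸ I₁) ⧸ ((Ideal.span {q₂} : Ideal Λ) • (⊤ : Submodule Λ (Λ ⧸ I₁)))) = p ^ J := by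
    rw [← hmap, Nat.card_congr (Submodule.quotientQuotientEquivQuotient I₁ (I₁ ⊔ (Ideal.span {q₂} : Ideal Λ) • ⊤)
      le_sup_left).toEquiv, hcountΛ]
  rw [← hker, ← PontryaginCard.natCard_characterModule, ← Nat.card_congr Ψ₂.toEquiv, hcount]

end Count

/-! ## §2 The count for the hull of `(A, γ)`, and the point-level residue system -/

section Hull

variable {p : ℕ} [Fact p.Prime]
variable {L : Type*} [AddCommGroup L] {A : AddSubgroup L} {γ : L → L}
variable {S : Type*} [AddCommGroup S] {φ : AddMonoid.End S}

/-- **`#{s : p^J s = 0 ∧ φ s = c s} = p^J` for every realization `(S, φ, ι_k)` of the hull of `(A, γ)`** whose two point-level inputs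
hold (pairwise dependence of the `γ`-fixed classes of `A/pA`; no finite cover of `A` mod `p`) and whose points have `p`-power `γ`-periods
(`hper`), `c ≡ 1 (mod p)`: the canonical dual pair `(Hom(S, ℚ/ℤ), id)` (`IsLocNil.module`) is free of rank one by
`nonempty_linearEquiv_of_hull`, then `natCard_torsionBy_eigen_eq_pow`. [cite: BDKim2007, Prop. 3.17] [cite: GreenbergLNM1716, §1 p. 60] -/
theorem natCard_torsionBy_eigen_eq_pow_of_hull (hγA : ∀ x ∈ A, γ x ∈ A)
    (ι : ℕ → (A →+ S)) (h0 : ∀ x : A, ι 0 x = 0) (hsucc : ∀ (k : ℕ) (x : A), p • ι (k + 1) x = ι k x)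
    (hsurj : ∀ s : S, ∃ (k : ℕ) (x : A), ι k x = s)
    (hker : ∀ (k : ℕ) (x : A), ι k x = 0 → ∃ w : A, (x : L) = p ^ k • (w : L))
    (hequiv : ∀ (k : ℕ) (x : A), φ (ι k x) = ι k ⟨γ x, hγA x x.2⟩)
    (hper : ∀ x : A, ∃ n : ℕ, γ^[p ^ n] (x : L) = x)
    (hdep : ∀ x ∈ A, ∀ y ∈ A, (∃ w ∈ A, γ x - x = p • w) → (∃ w ∈ A, γ y - y = p • w) →
      ∃ a b : ℤ, ¬ ((p : ℤ) ∣ a ∧ (p : ℤ) ∣ b) ∧ ∃ w ∈ A, a • x + b • y = p • w)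
    (hinf : ¬ ∃ F : Finset L, ∀ x ∈ A, ∃ r ∈ F, ∃ w ∈ A, x = r + p • w)
    (c : ℤ) (hc : (p : ℤ) ∣ c - 1) (J : ℕ) :
    Nat.card {s : S // p ^ J • s = 0 ∧ φ s = c • s} = p ^ J := by
  have hp : p.Prime := Fact.out
  have htor : ∀ (k : ℕ) (x : A), p ^ k • ι k x = 0 := by
    intro k
    induction k with
    | zero => intro x; rw [h0, smul_zero]
    | succ k ih => intro x; rw [pow_succ, mul_smul, hsucc, ih]
  -- iterates: `(φ^m) (ι k x) = ι k (γ^[m] x)`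
  have hiter : ∀ (m k : ℕ) (x : A), ∃ hx : γ^[m] (x : L) ∈ A, (φ ^ m) (ι k x) = ι k ⟨γ^[m] (x : L), hx⟩ := by
    intro m
    induction m with
    | zero => intro k x; exact ⟨x.2, by rw [pow_zero]; rfl⟩
    | succ m ih =>
      intro k x
      obtain ⟨hx, h⟩ := ih k x
      refine ⟨by rw [Function.iterate_succ_apply']; exact hγA _ hx, ?_⟩
      rw [pow_succ', AddMonoid.End.coe_mul, Function.comp_apply, h, hequiv]
      congr 1
      exact Subtype.ext (Function.iterate_succ_apply' γ m (x : L)).symm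
  have hloc : IsLocNil p (φ - 1) := by
    refine ⟨fun s ↦ ?_, fun s ↦ ?_⟩
    · obtain ⟨k, x, rfl⟩ := hsurj s
      exact ⟨k, htor k x⟩
    · obtain ⟨k, x, rfl⟩ := hsurj s
      obtain ⟨n, hn⟩ := hper x
      obtain ⟨hx, hφ⟩ := hiter (p ^ n) k x
      have hfix : (φ ^ p ^ n) (ι k x) = ι k x := by
        rw [hφ]; congr 1; exact Subtype.ext hn
      exact ⟨k * p ^ n, IwasawaDual.pow_mul_prime_pow_apply_eq_zero hp φ n hfix (htor k x)⟩
  -- the canonical dual pair `(Hom(S, ℚ/ℤ), id)`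
  letI : Module (PowerSeries ℤ_[p]) (S →+ AddCircle (1 : ℚ)) := hloc.module
  have hpair : IsDualPair p (φ - 1) (AddMonoidHom.id (S →+ AddCircle (1 : ℚ))) :=
    { bijective := Function.bijective_id
      T_smul := fun x s ↦ hloc.smulFun_X_apply x s
      C_smul := fun c' x s k hk ↦ hloc.smulFun_C_apply c' x hk
      locNil := hloc }
  obtain ⟨e⟩ := nonempty_linearEquiv_of_hull hpair hγA ι h0 hsucc hsurj hker hequiv hdep hinf
  exact natCard_torsionBy_eigen_eq_pow hpair e c hc J

/-- **POINT-LEVEL residue system of the twisted eigen-classes.** Same setting: for `c ≡ 1 (mod p)` and `J` there are EXACTLY `p^J`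
classes `{a ∈ A : γ a − c·a ∈ p^J A} / p^J A` — a finite set `R ⊆ A` of `p^J` representatives, pairwise incongruent modulo `p^J A`,
meeting every class. (The classes are the elements `s ∈ S` with `p^J s = 0`, `φ s = c s` via `a ↦ ι_J a`.) [cite: BDKim2007, Prop. 3.15] -/
theorem exists_residueSystem_eigen_of_hull (hγA : ∀ x ∈ A, γ x ∈ A)
    (ι : ℕ → (A →+ S)) (h0 : ∀ x : A, ι 0 x = 0) (hsucc : ∀ (k : ℕ) (x : A), p • ι (k + 1) x = ι k x)
    (hsurj : ∀ s : S, ∃ (k : ℕ) (x : A), ι k x = s)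
    (hker : ∀ (k : ℕ) (x : A), ι k x = 0 → ∃ w : A, (x : L) = p ^ k • (w : L))
    (hequiv : ∀ (k : ℕ) (x : A), φ (ι k x) = ι k ⟨γ x, hγA x x.2⟩)
    (hper : ∀ x : A, ∃ n : ℕ, γ^[p ^ n] (x : L) = x)
    (hdep : ∀ x ∈ A, ∀ y ∈ A, (∃ w ∈ A, γ x - x = p • w) → (∃ w ∈ A, γ y - y = p • w) →
      ∃ a b : ℤ, ¬ ((p : ℤ) ∣ a ∧ (p : ℤ) ∣ b) ∧ ∃ w ∈ A, a • x + b • y = p • w)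
    (hinf : ¬ ∃ F : Finset L, ∀ x ∈ A, ∃ r ∈ F, ∃ w ∈ A, x = r + p • w)
    (c : ℤ) (hc : (p : ℤ) ∣ c - 1) (J : ℕ) :
    ∃ R : Finset L, R.card = p ^ J ∧ (↑R : Set L) ⊆ A ∧ (∀ r ∈ R, ∃ w ∈ A, γ r - c • r = p ^ J • w) ∧
      (∀ r₁ ∈ R, ∀ r₂ ∈ R, (∃ w ∈ A, r₁ - r₂ = p ^ J • w) → r₁ = r₂) ∧
      (∀ a ∈ A, (∃ w ∈ A, γ a - c • a = p ^ J • w) → ∃ r ∈ R, ∃ w ∈ A, a - r = p ^ J • w) := by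
  have hp : p.Prime := Fact.out
  have hcount := natCard_torsionBy_eigen_eq_pow_of_hull hγA ι h0 hsucc hsurj hker hequiv hper hdep hinf c hc J
  set E := {s : S // p ^ J • s = 0 ∧ φ s = c • s} with hE
  haveI : Finite E := Nat.finite_of_card_ne_zero (by rw [hcount]; exact pow_ne_zero _ hp.ne_zero)
  letI : Fintype E := Fintype.ofFinite E
  -- bookkeeping along the tower of `ι`
  have htor : ∀ (k : ℕ) (x : A), p ^ k • ι k x = 0 := by
    intro k
    induction k with
    | zero => intro x; rw [h0, smul_zero]
    | succ k ih => intro x; rw [pow_succ, mul_smul, hsucc, ih]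
  have hdown : ∀ (m k : ℕ) (x : A), p ^ m • ι (k + m) x = ι k x := by
    intro m
    induction m with
    | zero => intro k x; rw [pow_zero, one_smul, add_zero]
    | succ m ih => intro k x; rw [pow_succ, mul_smul, ← add_assoc, hsucc, ih]
  have hshift : ∀ (m k : ℕ) (x : A), ι (k + m) (p ^ m • x) = ι k x := fun m k x ↦ by rw [map_nsmul, hdown]
  -- every `p^J`-torsion element is `ι J x`
  have hSJ : ∀ s : S, p ^ J • s = 0 → ∃ x : A, ι J x = s := by
    intro s hs
    obtain ⟨k, x, rfl⟩ := hsurj s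
    rcases le_or_gt k J with hkJ | hJk
    · obtain ⟨m, rfl⟩ := Nat.exists_eq_add_of_le hkJ
      exact ⟨p ^ m • x, hshift m k x⟩
    · obtain ⟨m, rfl⟩ := Nat.exists_eq_add_of_lt hJk
      have h1 : ι (m + 1) x = 0 := by rw [← hdown J (m + 1) x, show m + 1 + J = J + m + 1 by ring]; exact hs
      obtain ⟨w, hw⟩ := hker (m + 1) x h1
      have hx : x = p ^ (m + 1) • w := Subtype.ext (by rw [hw, AddSubgroup.coe_nsmul])
      refine ⟨w, ?_⟩
      rw [hx, show J + m + 1 = J + (m + 1) by ring, hshift]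
  -- `φ (ι J x) = c • ι J x ↔ γ x − c x ∈ p^J A`
  have heig : ∀ x : A, φ (ι J x) = c • ι J x ↔ ∃ w ∈ A, γ x - c • (x : L) = p ^ J • w := by
    intro x
    rw [hequiv, ← map_zsmul, ← sub_eq_zero, ← map_sub]
    constructor
    · intro h
      obtain ⟨w, hw⟩ := hker J _ h
      exact ⟨w, w.2, by rw [← hw, AddSubgroup.coe_sub, AddSubgroup.coe_zsmul]⟩
    · rintro ⟨w, hwA, hw⟩
      have e1 : (⟨γ x, hγA x x.2⟩ - c • x : A) = p ^ J • (⟨w, hwA⟩ : A) :=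
        Subtype.ext (by rw [AddSubgroup.coe_sub, AddSubgroup.coe_zsmul, AddSubgroup.coe_nsmul]; exact hw)
      rw [e1, map_nsmul, htor]
  -- a section of `ι J` on the eigenspace
  have hsec : ∀ s : E, ∃ x : A, ι J x = s.1 := fun s ↦ hSJ s.1 s.2.1
  choose sec hsec using hsec
  have hsec_inj : Function.Injective (fun s : E ↦ ((sec s : A) : L)) := by
    intro s₁ s₂ h12
    have h' : sec s₁ = sec s₂ := Subtype.ext h12
    exact Subtype.ext (by rw [← hsec s₁, ← hsec s₂, h'])
  refine ⟨Finset.univ.image (fun s : E ↦ ((sec s : A) : L)), ?_, ?_, ?_, ?_, ?_⟩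
  · rw [Finset.card_image_of_injective _ hsec_inj, Finset.card_univ, ← Nat.card_eq_fintype_card, hcount]
  · intro r hr
    obtain ⟨s, -, rfl⟩ := Finset.mem_image.mp hr
    exact (sec s).2
  · intro r hr
    obtain ⟨s, -, rfl⟩ := Finset.mem_image.mp hr
    have h := s.2.2
    rw [← hsec s] at h
    exact (heig (sec s)).mp h
  · intro r₁ hr₁ r₂ hr₂ ⟨w, hwA, hw⟩
    obtain ⟨s₁, -, rfl⟩ := Finset.mem_image.mp hr₁
    obtain ⟨s₂, -, rfl⟩ := Finset.mem_image.mp hr₂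
    have e1 : (sec s₁ - sec s₂ : A) = p ^ J • (⟨w, hwA⟩ : A) :=
      Subtype.ext (by rw [AddSubgroup.coe_sub, AddSubgroup.coe_nsmul]; exact hw)
    have e2 : s₁.1 = s₂.1 := by
      rw [← hsec s₁, ← hsec s₂, ← sub_eq_zero, ← map_sub, e1, map_nsmul, htor]
    rw [Subtype.ext e2]
  · intro a ha heiga
    have hs : p ^ J • ι J ⟨a, ha⟩ = 0 ∧ φ (ι J ⟨a, ha⟩) = c • ι J ⟨a, ha⟩ := ⟨htor J _, (heig ⟨a, ha⟩).mpr heiga⟩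
    let s : E := ⟨ι J ⟨a, ha⟩, hs⟩
    refine ⟨((sec s : A) : L), Finset.mem_image.mpr ⟨s, Finset.mem_univ _, rfl⟩, ?_⟩
    have h1 : ι J (⟨a, ha⟩ - sec s) = 0 := by rw [map_sub, hsec s, sub_self]
    obtain ⟨w, hw⟩ := hker J _ h1
    rw [AddSubgroup.coe_sub] at hw
    exact ⟨w, w.2, hw⟩

end Hull

end Summit.BirchSwinnertonDyer.BirchSwinnertonDyer.Theorems.ResidualThetaLayer.PlusDual

/-! ## §3 `K = ℚ`, `p = 2`: the residue system of the twisted eigen-classes of `(⋃ₙ E⁺(ℚ_{2,n}))/2^J`, unconditionally -/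

namespace Summit.BirchSwinnertonDyer.BirchSwinnertonDyer.Theorems.SignedEC.PlusDualTwo

open Literature.NumberTheory.GaloisRepresentations WeierstrassCurve ZpExtension
  Literature.NumberTheory.EllipticCurves.Kobayashi2003 Literature.NumberTheory.EllipticCurves.Sprung2012
  Summit.BirchSwinnertonDyer.Rank1Residual.Additive NumberField IsDedekindDomain

variable (W : WeierstrassCurve ℚ) [W.IsElliptic] [W.IsGloballyMinimal]

/-- **`#((⋃ₙ E⁺(ℚ_{2,n})) / 2^J)^{g = c} = 2^J`, as a residue system of points — UNCONDITIONALLY.** For `W/ℚ` globally minimal with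
good supersingular reduction at `2` and `a₂(W) = 0`, `κ` cyclotomic, `v ∋ 2`, `g ∈ Γ_{ℚ_v}` a local lift of the topological generator,
`A = ⋃ₙ E⁺(ℚ_{2,n})`, every odd `c ∈ ℤ` and every `J`: there are EXACTLY `2^J` classes `{a ∈ A : g•a − c•a ∈ 2^J A} / 2^J A`
(a set `R ⊆ A` of `2^J` representatives, pairwise incongruent mod `2^J A`, meeting every such class). Inputs: `exists_divisibleHull`,
(R1)@2 through `natCard_torsionBy_eigen_eq_pow_of_hull` (`PlusModP.plusFixedModTwo_dep_iSup_two`, `PlusRankGrowth.not_exists_finset_cover_mod_two`).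
This is `#L_u = 2^J` for the signed local Kummer condition read on points (`c = χ_u(g)^{∓1}`). [cite: BDKim2007, Prop. 3.15 and Prop. 3.17] -/
theorem exists_residueSystem_plusEigen_two (hss : Rank1Residual.GoodSS W 2) (ha : W.frobeniusTrace 2 = 0)
    {κ : ZpExtension ℚ 2} (hκ : κ.IsCyclotomic) (v : HeightOneSpectrum (𝓞 ℚ)) (hv : (2 : 𝓞 ℚ) ∈ v.asIdeal)
    {g : Field.absoluteGaloisGroup (v.adicCompletion ℚ)}
    (hg : κ.IsTopGenerator (resGalOfEmb (closureEmb (K := ℚ) (v.adicCompletion ℚ)) g)) (c : ℤ) (hc : (2 : ℤ) ∣ c - 1) (J : ℕ) :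
    ∃ R : Finset (localPoints W (v.adicCompletion ℚ)), R.card = 2 ^ J ∧
      (↑R : Set (localPoints W (v.adicCompletion ℚ))) ⊆
        ((⨆ n, signedLocalPoints κ (v.adicCompletion ℚ) W 1 n : AddSubgroup (localPoints W (v.adicCompletion ℚ))) :
          Set (localPoints W (v.adicCompletion ℚ))) ∧
      (∀ r ∈ R, ∃ w ∈ (⨆ n, signedLocalPoints κ (v.adicCompletion ℚ) W 1 n), g • r - c • r = 2 ^ J • w) ∧
      (∀ r₁ ∈ R, ∀ r₂ ∈ R, (∃ w ∈ (⨆ n, signedLocalPoints κ (v.adicCompletion ℚ) W 1 n), r₁ - r₂ = 2 ^ J • w) → r₁ = r₂) ∧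
      (∀ a ∈ (⨆ n, signedLocalPoints κ (v.adicCompletion ℚ) W 1 n),
        (∃ w ∈ (⨆ n, signedLocalPoints κ (v.adicCompletion ℚ) W 1 n), g • a - c • a = 2 ^ J • w) →
        ∃ r ∈ R, ∃ w ∈ (⨆ n, signedLocalPoints κ (v.adicCompletion ℚ) W 1 n), a - r = 2 ^ J • w) := by
  haveI : Fact (Nat.Prime 2) := ⟨Nat.prime_two⟩
  set ι₀ := closureEmb (K := ℚ) (v.adicCompletion ℚ) with hι₀
  set A : AddSubgroup (localPoints W (v.adicCompletion ℚ)) := ⨆ n, signedLocalPoints κ (v.adicCompletion ℚ) W 1 n with hAdef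
  have hγA : ∀ x ∈ A, g • x ∈ A := fun x hx ↦ smul_mem_iSup_signedLocalPoints W κ v g hx
  have hAtower : A ≤ Sprung2012.localTowerPointsOfEmb κ ι₀ W := iSup_signedLocalPoints_le_localTowerPointsOfEmb W κ v
  -- no `2`-torsion on `A`
  have hA2 : ∀ a : A, 2 • a = 0 → a = 0 := fun a h2 ↦ Subtype.ext
    (SSFlatEC.eq_zero_of_mem_localTowerPointsOfEmb_of_two_nsmul W hss κ (by exact_mod_cast hv) ι₀ (hAtower a.2)
      (by rw [← AddSubgroup.coe_nsmul, h2, AddSubgroup.coe_zero]))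
  -- the `g`-action on `A` as an additive endomorphism
  let γA : A →+ A := ((DistribSMul.toAddMonoidHom (localPoints W (v.adicCompletion ℚ)) g).comp A.subtype).codRestrict A
    fun x ↦ hγA x x.2
  have hγA_apply : ∀ x : A, ((γA x : A) : localPoints W (v.adicCompletion ℚ)) = g • (x : localPoints W (v.adicCompletion ℚ)) :=
    fun _ ↦ rfl
  obtain ⟨S, _, φ, ι, h0, hsucc, hsurj, hker, hequiv⟩ := ResidualThetaLayer.PlusDual.exists_divisibleHull (p := 2) A hA2 γA
  have hker' : ∀ (k : ℕ) (x : A), ι k x = 0 → ∃ w : A, (x : localPoints W (v.adicCompletion ℚ)) = 2 ^ k • (w : localPoints W _) :=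
    fun k x hx ↦ by obtain ⟨w, hw⟩ := hker k x hx; exact ⟨w, by rw [hw, AddSubgroup.coe_nsmul]⟩
  have hequiv' : ∀ (k : ℕ) (x : A), (φ : AddMonoid.End S) (ι k x) = ι k ⟨g • (x : localPoints W _), hγA x x.2⟩ := by
    intro k x
    rw [show (φ : AddMonoid.End S) (ι k x) = φ (ι k x) from rfl, hequiv]
    rfl
  -- `2`-power periods: `x ∈ E⁺(ℚ_{2,m})` is fixed by `g^{2^m}`
  have hper : ∀ x : A, ∃ n : ℕ, (fun y : localPoints W (v.adicCompletion ℚ) ↦ g • y)^[2 ^ n] (x : localPoints W _) = x := by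
    intro x
    obtain ⟨m, hxm⟩ := (AddSubgroup.mem_iSup_of_directed (signedLocalPointsOfEmb_mono κ ι₀ W 1).directed_le).1 x.2
    refine ⟨m, ?_⟩
    rw [smul_iterate]
    simpa using Sprung2012.pow_mul_smul_of_mem_localLayerPointsOfEmb κ ι₀ W hg
      (((mem_signedLocalPointsOfEmb_iff κ ι₀ W 1 m _).1 hxm).1) 1
  refine ResidualThetaLayer.PlusDual.exists_residueSystem_eigen_of_hull (φ := (φ : AddMonoid.End S)) (γ := fun y ↦ g • y) hγA
    ι h0 hsucc hsurj hker' hequiv' hper ?_ ?_ c hc J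
  · exact PlusModP.plusFixedModTwo_dep_iSup_two W hss ha hκ v hv hg
  · rintro ⟨F, hF⟩
    refine PlusRankGrowth.not_exists_finset_cover_mod_two W hss ha κ hκ v hv ⟨F, fun x hx ↦ ?_⟩
    obtain ⟨r, hr, w, hw, hxe⟩ := hF x hx
    exact ⟨r, hr, w, hAtower hw, hxe⟩

end Summit.BirchSwinnertonDyer.BirchSwinnertonDyer.Theorems.SignedEC.PlusDualTwo

end
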